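import Literature.AlgebraicGeometry.Resolution.Temkin2008
import Literature.AlgebraicGeometry.Resolution.ResolutionOfComponents
import HarnessLib

/-!
# Resolution in characteristic zero over fields from Temkin's theorem

Topic: `Literature/AlgebraicGeometry/Resolution`. The characteristic-zero half of the resolution
statements of this topic, derived from the named fact `Temkin2008` (Temkin 2008, Thm. 1.1:
Noetherian quasi-excellent integral schemes with residue fields of characteristic zero admit a
desingularization) and excellence of finite type algebras over fields (`Stacks07QW_field`):

* `charZero_residueField_of_over_field` — the residue fields of a scheme over a field of
  characteristic zero have characteristic zero;
* `Temkin2008.integralResolutionInChar_zero`, `Temkin2008.resolutionInChar_zero` — resolution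
  of reduced separated schemes of finite type over fields of characteristic `0`
  (`ResolutionInChar 0`), i.e. `Temkin2008.hironaka1964 : Temkin2008 → Stacks07QW_field →
  Hironaka1964` (the reduced case via the components, `resolutionInChar_iff_integral`);
* `Temkin2008.resolutionOverUpToDim` — `ResolutionOverUpToDim k d` for every field `k` of
  characteristic `0` and every `d`; in particular the characteristic-zero part of
  `CossartPiltant2019` (`Temkin2008.cossartPiltant2019_charZero`);
* `Temkin2008.localUniformizationInChar_zero`, `Temkin2008.relLocalUniformization_charZero` —
  Zariski's local uniformization in characteristic zero (absolute and relative forms), via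
  `ResolutionLU.lean`.

## Sources

* M. Temkin, Adv. Math. 219 (2008) 488–522, Thm. 1.1. [Temkin2008]
* H. Hironaka, Ann. of Math. 79 (1964), Main Theorem I. [Hironaka1964]
* The Stacks Project, Tag 07QW. [StacksProject]
-/

noncomputable section

open CategoryTheory AlgebraicGeometry TopologicalSpace

namespace Literature.AlgebraicGeometry.Resolution

universe u

/-- The residue fields of a scheme over a field `k` of characteristic zero have characteristic
zero (they are `k`-algebras). [folklore] -/
theorem charZero_residueField_of_over_field {k : Type u} [Field k] [CharZero k] {X : Scheme.{u}}
    (f : X ⟶ Spec (.of k)) (x : X) : CharZero (X.residueField x) := by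
  let e : k ≃+* Γ(Spec (.of k), ⊤) := (Scheme.ΓSpecIso (.of k)).commRingCatIsoToRingEquiv.symm
  let φ : k →+* X.residueField x :=
    (X.evaluation ⊤ x trivial).hom.comp ((f.appTop).hom.comp e.toRingHom)
  refine charZero_of_ringHom_of_isUnit_natCast φ fun n hn => ?_
  exact isUnit_iff_ne_zero.mpr (Nat.cast_ne_zero.mpr hn)

/-- **Resolution of integral schemes of finite type over fields of characteristic zero from
Temkin's theorem**: `IntegralResolutionInChar 0` (such schemes are Noetherian, excellent by
`Stacks07QW_field`, and have residue fields of characteristic zero).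
[cite: Temkin2008, Thm. 1.1] -/
theorem Temkin2008.integralResolutionInChar_zero (h : Temkin2008.{u}) (h07 : Stacks07QW_field.{u}) :
    IntegralResolutionInChar.{u} 0 := by
  intro k _ _ X f hsep hft hqc hint
  haveI : IsNoetherian X := Scheme.isNoetherian_of_finiteType_over_field f
  haveI : CharZero k := CharP.charP_to_charZero k
  exact h X (Scheme.isQuasiExcellent_of_locallyOfFiniteType h07 f)
    (charZero_residueField_of_over_field f)

/-- **`ResolutionInChar 0` from Temkin's theorem** (reduced schemes via their irreducible
components, `resolutionInChar_iff_integral`). [cite: Temkin2008, Thm. 1.1] -/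
theorem Temkin2008.resolutionInChar_zero (h : Temkin2008.{u}) (h07 : Stacks07QW_field.{u}) :
    ResolutionInChar.{u} 0 :=
  (resolutionInChar_iff_integral 0).mpr (h.integralResolutionInChar_zero h07)

/-- **Hironaka's theorem (weak form `Hironaka1964`) from Temkin 2008 and `Stacks07QW_field`.**
(Temkin's Thm. 1.1 itself rests on resolution for varieties in characteristic zero —
Hironaka 1964 / Bierstone–Milman — so this is a re-rooting of the named fact, not an independent
proof.) [cite: Temkin2008, Thm. 1.1] [cite: Hironaka1964, Main Theorem I] -/
theorem Temkin2008.hironaka1964 (h : Temkin2008.{u}) (h07 : Stacks07QW_field.{u}) :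
    Hironaka1964.{u} :=
  h.resolutionInChar_zero h07

/-- **Weak resolution over fields of characteristic zero in every dimension** from Temkin 2008,
Thm. 1.1: `ResolutionOverUpToDim k d` for `char k = 0`. [cite: Temkin2008, Thm. 1.1] -/
theorem Temkin2008.resolutionOverUpToDim (h : Temkin2008.{u}) (h07 : Stacks07QW_field.{u})
    (k : Type u) [Field k] [CharZero k] (d : ℕ) : ResolutionOverUpToDim k d := by
  intro X f hsep hft hqc hred _
  haveI : CharP k 0 := CharP.ofCharZero k
  exact h.resolutionInChar_zero h07 k X f hsep hft hqc hred

/-- **The characteristic-zero part of `CossartPiltant2019`** from Temkin's theorem: over every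
field of characteristic zero, reduced separated schemes of finite type of dimension `≤ 3` (indeed
of any dimension) admit a resolution. [cite: Temkin2008, Thm. 1.1] -/
theorem Temkin2008.cossartPiltant2019_charZero (h : Temkin2008.{u}) (h07 : Stacks07QW_field.{u})
    (k : Type u) [Field k] [CharZero k] (X : Scheme.{u}) (f : X ⟶ Spec (.of k))
    [IsSeparated f] [LocallyOfFiniteType f] [QuasiCompact f] [IsReduced X]
    (hdim : topologicalKrullDim X ≤ 3) : Scheme.HasResolution X :=
  h.resolutionOverUpToDim h07 k 3 X f ‹_› ‹_› ‹_› ‹_› (by exact_mod_cast hdim)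

/-- **Zariski's local uniformization theorem in characteristic zero (1940), from Temkin 2008**:
`LocalUniformizationInChar 0` (via `Temkin2008.resolutionInChar_zero` and
`ResolutionInChar.localUniformizationInChar` of `ResolutionLU.lean`).
[cite: Temkin2008, Thm. 1.1] -/
theorem Temkin2008.localUniformizationInChar_zero (h : Temkin2008.{u})
    (h07 : Stacks07QW_field.{u}) : LocalUniformizationInChar.{u} 0 :=
  (h.resolutionInChar_zero h07).localUniformizationInChar

/-- **Relative local uniformization over fields of characteristic zero from Temkin 2008**:
`RelLocalUniformization k K O` for every field `k` of characteristic `0`, every `K/k` and every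
valuation ring `O` of `K` (the relative form consumed by route `Valuative`).
[cite: Temkin2008, Thm. 1.1] -/
theorem Temkin2008.relLocalUniformization_charZero (h : Temkin2008.{0}) (h07 : Stacks07QW_field.{0})
    (k K : Type) [Field k] [CharZero k] [Field K] [Algebra k K] (O : ValuationSubring K) :
    RelLocalUniformization k K O := by
  haveI : CharP k 0 := CharP.ofCharZero k
  exact (h.resolutionInChar_zero h07).relLocalUniformization k K O

end Literature.AlgebraicGeometry.Resolution

end
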